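import Literature.NumberTheory.EllipticCurves.BSDRootNumberProofs
import Literature.NumberTheory.EllipticCurves.CuspFormLFunctionAtkinLehnerProofs
import Literature.NumberTheory.EllipticCurves.NewformsLevelRaising
import Literature.NumberTheory.EllipticCurves.NewformsOldNewProofs
import Literature.NumberTheory.EllipticCurves.NewformsMainLemmaTraceProofs
import Literature.NumberTheory.Automorphic.BCDTModularity
import HarnessLib

/-!
# The functional equation of the raw product `N_E^{s/2}(2π)^{-s}Γ(s)L(E,s)` on the critical strip
# (proofs for `Literature.NumberTheory.EllipticCurves.BSDRootNumber`, fact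
# `Literature.NumberTheory.EllipticCurves.completedLFunction_functional_equation_strip`, **bsd.S08**)

D-0014 keeps `Literature/` sorry-free by stating cited results as named facts `def X : Prop`.
The fact `Literature.BSD.completedLFunction_functional_equation_strip W` says: for an elliptic curve
`E/ℚ` given by `W`, of conductor `N_E = W.conductorNorm ℤ`, and `0 < re s < 2`,
`Λ_raw(2 − s) = w(E) Λ_raw(s)` for the raw product
`Λ_raw(s) = W.completedLFunction N_E s = N_E^{s/2} (2π)^{-s} Γ(s) L(E,s)` and the analytic root
number `w(E) = W.rootNumber`. Its source is the Modularity Theorem — Breuil–Conrad–Diamond–Taylor,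
JAMS 14 (2001), **Theorem A** (p. 843: "If `E/ℚ` is an elliptic curve, then `E` is modular"),
where "modular" is any of the equivalent conditions (1)–(6) of their §1 (p. 845), condition (2)
being "`L(E, s) = L(f, s)` for some eigenform `f` of weight `2` and level `N(E)`" (the reduction
to level `N(E)` is Carayol's theorem) — combined with Hecke's theory of the newform `f`:
`Λ(f, s)` is entire and `Λ(f, s) = ± Λ(f, 2 − s)` (Hecke 1936; Atkin–Lehner 1970, Thm. 3).

**Status of the discharge.** An unconditional
`completedLFunction_functional_equation_strip_holds` would contain the analytic continuation of
`L(E, s)` to `0 < re s ≤ 3/2` together with its functional equation, i.e. the Modularity Theorem,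
which Mathlib does not have and which `Literature/` carries as the named fact
`Literature.NumberTheory.EllipticCurves.ModularForms.exists_isNewformOf` (`CuspFormLFunction`). Everything between that input and the
fact is proved in the tree; this file only records the **end of the chain for the strip fact**
(the sibling files stop at `completedLFunction_functional_equation`):

* `BSDRootNumberProofs`: `WeierstrassCurve.completedLFunction_two_sub_holds` (complex analysis:
  an entire continuation `Λ` of the completed `L`-function forces `L(E, ·)` to be entire, so the
  raw product equals `Λ` on `re s > 0`) and
  `completedLFunction_functional_equation_strip_of_completedLFunction_functional_equation`
  (strip fact ⇐ bsd.S08 `completedLFunction_functional_equation`, the prelude's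
  `WeierstrassCurve.hasFunctionalEquationSign_rootNumber` unfolded);
* `BSDRootNumberProofs`: `completedLFunction_functional_equation_of_modularity`
  (⇐ `exists_isNewformOf` and Hecke's functional equation with sign for weight-`2` newforms,
  `Literature.NumberTheory.EllipticCurves.ModularForms.IsNewform0.exists_functional_equation`, the sign `i² ε_f` being identified
  with `(−1)^{r_an} = ±1` by the order-of-vanishing argument);
* `CuspFormLFunctionFrickeProofs`, `CuspFormLFunctionAtkinLehnerProofs`,
  `BSDRootNumberMainLemmaProofs`: Hecke's functional equation for newforms is proved up to the
  Atkin–Lehner Main Lemma `Literature.ModularForms.atkinLehnerMainLemma0 N 2` (Atkin–Lehner 1970,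
  Thm. 1; `NewformsLevelRaising`), or alternatively up to Atkin–Lehner's Multiplicity One Theorem
  `Literature.ModularForms.atkinLehner_multiplicityOne N 2` (Knapp, *Elliptic Curves*, Thm. 9.22).

This file imports the same modules as `BSDRootNumberMainLemmaProofs` and repeats its three-line
derivation of Hecke's functional equation from the Main Lemma inline (rather than importing it).

Hence the first group of theorems below: the strip fact (and the remaining bsd.S08 statements
about the chosen continuation `W.completedLContinuation N_E`, for completeness) from exactly **two
named facts**, `exists_isNewformOf` (BCDT 2001, Thm. A) and `atkinLehnerMainLemma0 N 2` for all `N`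
(Atkin–Lehner 1970, Thm. 1).

**Second instalment (the Main Lemma is now a theorem).** Since the first group landed, the
Atkin–Lehner Main Lemma has been *proved* in the tree,
`Literature.NumberTheory.EllipticCurves.ModularForms.atkinLehnerMainLemma0_holds` (`NewformsMainLemmaTraceProofs`, an elementary
proof by traces; independently, the sibling
`CuspFormLFunctionNewformFrickeProofs` proves Hecke's functional equation with sign for newforms
in every weight, `Literature.NumberTheory.EllipticCurves.ModularForms.IsNewform0.exists_functional_equation_holds`). The last
section therefore records:

* the **per-curve** form of the source — BCDT's condition (2) of §1 for the given curve, i.e. a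
  newform `f ∈ S₂(Γ₀(N_E))` with `aₙ(f) = aₙ(E)` (`Literature.ModularForms.IsNewformOf W f`,
  equivalently `Literature.BCDT.IsModular W`), already implies the strip fact for that curve
  (`completedLFunction_functional_equation_strip_of_isNewformOf`, `…_of_isModular`), with no
  named fact as input;
* the strip fact for every curve from the **single** named fact `exists_isNewformOf` = BCDT
  Thm. A (`completedLFunction_functional_equation_strip_of_exists_isNewformOf`; a primed variant
  goes through the end-of-chain theorem of the first group instead);
* the strip fact from the two results out of which BCDT §2.2 assemble Thm. A = Thm. 2.2.2, namely
  their Theorem B (= Thm. 2.2.1) and Conrad–Diamond–Taylor 1999, Thm. 7.2.4, as vendored and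
  assembled in `Literature.NumberTheory.Automorphic.BCDTModularity`
  (`completedLFunction_functional_equation_strip_of_theoremB_of_CDT`): the trust base of
  `completedLFunction_functional_equation_strip` in the tree is thereby
  {`Literature.NumberTheory.Automorphic.BCDT.theoremB`, `Literature.NumberTheory.Automorphic.BCDT.CDT_theorem_7_2_4`}, and
  `completedLFunction_functional_equation_strip_holds W` will be the one-liner
  `completedLFunction_functional_equation_strip_of_exists_isNewformOf W exists_isNewformOf_holds`
  once the Modularity Theorem is a theorem of the tree.

## References

* C. Breuil, B. Conrad, F. Diamond, R. Taylor, *On the modularity of elliptic curves over `ℚ`: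
  wild 3-adic exercises*, J. Amer. Math. Soc. 14 (2001), 843–939, Thm. A (p. 843) and §1,
  conditions (1)–(6) (p. 845).
* A. O. L. Atkin, J. Lehner, *Hecke operators on `Γ₀(m)`*, Math. Ann. 185 (1970), 134–160, Thm. 1,
  Thm. 3.
* B. Conrad, F. Diamond, R. Taylor, *Modularity of certain potentially Barsotti–Tate Galois
  representations*, J. Amer. Math. Soc. 12 (1999), 521–567, Thm. 7.2.4.
* F. Diamond, J. Shurman, *A First Course in Modular Forms*, GTM 228, Springer 2005, Thm. 5.10.2,
  Thm. 8.8.3.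
* J. H. Silverman, *The Arithmetic of Elliptic Curves*, 2nd ed., GTM 106, Springer 2009, C.16,
  Thm. 16.3.
* A. W. Knapp, *Elliptic Curves*, Princeton Math. Notes 40 (1992), Thm. 9.22.
-/

noncomputable section

namespace Literature.NumberTheory.EllipticCurves

variable (W : WeierstrassCurve ℚ)

/-! ### The strip fact from modularity and Hecke's functional equation for newforms -/

/-- bsd.S08 `completedLFunction_functional_equation_strip W` — the functional equation
`Λ_raw(2 − s) = w(E) Λ_raw(s)` of the raw product `N_E^{s/2}(2π)^{-s}Γ(s)L(E, s)` on
`0 < re s < 2` — from the modular-forms-level named facts `Literature.NumberTheory.EllipticCurves.ModularForms.exists_isNewformOf`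
(Modularity Theorem: Breuil–Conrad–Diamond–Taylor 2001, Thm. A, in the form (2) of their §1,
level `N(E)` by Carayol; Diamond–Shurman Thm. 8.8.3) and
`Literature.NumberTheory.EllipticCurves.ModularForms.IsNewform0.exists_functional_equation` in weight `2` at every level (Hecke 1936;
Atkin–Lehner 1970, Thm. 3), via `completedLFunction_functional_equation_of_modularity` and the
discharged prelude fact `WeierstrassCurve.completedLFunction_two_sub_holds`.
[cite: BCDTJAMS2001, Thm. A and §1 (2)] [cite: DiamondShurman2005, Thm. 5.10.2 and Thm. 8.8.3] -/
theorem completedLFunction_functional_equation_strip_of_modularity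
    (hmod : Literature.NumberTheory.EllipticCurves.ModularForms.exists_isNewformOf)
    (hfe : ∀ (N : ℕ) [NeZero N],
      Literature.NumberTheory.EllipticCurves.ModularForms.IsNewform0.exists_functional_equation (N := N) (k := 2)) :
    completedLFunction_functional_equation_strip W :=
  completedLFunction_functional_equation_strip_of_completedLFunction_functional_equation
    (completedLFunction_functional_equation_of_modularity W hmod hfe)

/-! ### End of chain: the strip fact from exactly two named facts -/

/-- **bsd.S08, raw-product functional equation on the strip, from modularity and the Atkin–Lehner
Main Lemma.** The fact `completedLFunction_functional_equation_strip W` from exactly two named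
facts: the Modularity Theorem `Literature.NumberTheory.EllipticCurves.ModularForms.exists_isNewformOf` (Breuil–Conrad–Diamond–Taylor
2001, Thm. A) and the Atkin–Lehner Main Lemma `Literature.ModularForms.atkinLehnerMainLemma0 N 2` for all
levels `N` (Atkin–Lehner 1970, Thm. 1); Hecke's functional equation with sign for weight-`2`
newforms is obtained from the Main Lemma exactly as in `BSDRootNumberMainLemmaProofs`
(`IsNewform0.frickeFacts_of_mainLemma` of `CuspFormLFunctionAtkinLehnerProofs`, fed with
`atkinLehnerMainLemma0.mem_oldSubspace0` and the proved `disjoint_oldSubspace0_newSubspace0_holds`).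
[cite: BCDTJAMS2001, Thm. A] [cite: AtkinLehner1970, Thm. 1] -/
theorem completedLFunction_functional_equation_strip_of_exists_isNewformOf_of_atkinLehnerMainLemma0
    (hmod : Literature.NumberTheory.EllipticCurves.ModularForms.exists_isNewformOf)
    (hML : ∀ (N : ℕ) [NeZero N], Literature.NumberTheory.EllipticCurves.ModularForms.atkinLehnerMainLemma0 N 2) :
    completedLFunction_functional_equation_strip W :=
  completedLFunction_functional_equation_strip_of_completedLFunction_functional_equation
    (completedLFunction_functional_equation_of_modularity W hmod fun N _ ↦
      (Literature.NumberTheory.EllipticCurves.ModularForms.IsNewform0.frickeFacts_of_mainLemma N 2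
        (fun h hh ↦ (hML N).mem_oldSubspace0 N 2 h hh)
        (Literature.NumberTheory.EllipticCurves.ModularForms.disjoint_oldSubspace0_newSubspace0_holds N 2)).2.2.2)

/-- Variant: the strip fact `completedLFunction_functional_equation_strip W` from modularity and
Atkin–Lehner's Multiplicity One Theorem `Literature.ModularForms.atkinLehner_multiplicityOne N 2` in
weight `2` at every level (Knapp, *Elliptic Curves*, Thm. 9.22; Atkin–Lehner 1970), via
`Literature.NumberTheory.EllipticCurves.ModularForms.IsNewform0.exists_functional_equation_two_of_atkinLehner`
(`CuspFormLFunctionAtkinLehnerProofs`). [cite: BCDTJAMS2001, Thm. A]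
[cite: Knapp1993, Thm. 9.22 (§IX.7, p. 283)] -/
theorem completedLFunction_functional_equation_strip_of_exists_isNewformOf_of_atkinLehner
    (hmod : Literature.NumberTheory.EllipticCurves.ModularForms.exists_isNewformOf)
    (hA : ∀ (N : ℕ) [NeZero N], Literature.NumberTheory.EllipticCurves.ModularForms.atkinLehner_multiplicityOne N 2) :
    completedLFunction_functional_equation_strip W :=
  completedLFunction_functional_equation_strip_of_completedLFunction_functional_equation
    (completedLFunction_functional_equation_of_modularity W hmod
      (Literature.NumberTheory.EllipticCurves.ModularForms.IsNewform0.exists_functional_equation_two_of_atkinLehner hA))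

/-! ### The remaining bsd.S08 statements about the chosen continuation, from the same two named facts -/

/-- bsd.S08 `Λ(E, 2 − s) = w(E) Λ(E, s)` for all `s`, for the chosen entire continuation
`W.completedLContinuation N_E` (the statement of
`Literature.NumberTheory.EllipticCurves.completedLContinuation_two_sub`, unfolded; a separate
named fact until the D-0026 merge of 2026-08-15, see `BSDRootNumberTwoSubProofs`), from modularity
and the Atkin–Lehner Main Lemma (via that theorem of the statement file,
`completedLContinuation_two_sub`: uniqueness of the entire continuation).
[cite: BCDTJAMS2001, Thm. A] [cite: AtkinLehner1970, Thm. 1] -/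
theorem completedLContinuation_two_sub_of_exists_isNewformOf_of_atkinLehnerMainLemma0
    (hmod : Literature.NumberTheory.EllipticCurves.ModularForms.exists_isNewformOf)
    (hML : ∀ (N : ℕ) [NeZero N], Literature.NumberTheory.EllipticCurves.ModularForms.atkinLehnerMainLemma0 N 2)
    [W.IsElliptic] (s : ℂ) :
    W.completedLContinuation (W.conductorNorm ℤ) (2 - s) =
      W.rootNumber * W.completedLContinuation (W.conductorNorm ℤ) s :=
  completedLContinuation_two_sub W
    (completedLFunction_functional_equation_of_modularity W hmod fun N _ ↦
      (Literature.NumberTheory.EllipticCurves.ModularForms.IsNewform0.frickeFacts_of_mainLemma N 2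
        (fun h hh ↦ (hML N).mem_oldSubspace0 N 2 h hh)
        (Literature.NumberTheory.EllipticCurves.ModularForms.disjoint_oldSubspace0_newSubspace0_holds N 2)).2.2.2) s

/-- bsd.S08 `differentiable_completedLContinuation W` (the chosen continuation
`W.completedLContinuation N_E` is entire) from modularity and the Atkin–Lehner Main Lemma (via
`differentiable_completedLContinuation_of_completedLFunction_functional_equation`).
[cite: BCDTJAMS2001, Thm. A] [cite: AtkinLehner1970, Thm. 1] -/
theorem differentiable_completedLContinuation_of_exists_isNewformOf_of_atkinLehnerMainLemma0
    (hmod : Literature.NumberTheory.EllipticCurves.ModularForms.exists_isNewformOf)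
    (hML : ∀ (N : ℕ) [NeZero N], Literature.NumberTheory.EllipticCurves.ModularForms.atkinLehnerMainLemma0 N 2) :
    differentiable_completedLContinuation W :=
  differentiable_completedLContinuation_of_completedLFunction_functional_equation
    (completedLFunction_functional_equation_of_modularity W hmod fun N _ ↦
      (Literature.NumberTheory.EllipticCurves.ModularForms.IsNewform0.frickeFacts_of_mainLemma N 2
        (fun h hh ↦ (hML N).mem_oldSubspace0 N 2 h hh)
        (Literature.NumberTheory.EllipticCurves.ModularForms.disjoint_oldSubspace0_newSubspace0_holds N 2)).2.2.2)

/-- bsd.S08 `completedLContinuation_eq_completedLFunction W` (the chosen continuation agrees with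
the raw product on `re s > 3/2`) from modularity and the Atkin–Lehner Main Lemma (via
`completedLContinuation_eq_completedLFunction_of_completedLFunction_functional_equation`).
[cite: BCDTJAMS2001, Thm. A] [cite: AtkinLehner1970, Thm. 1] -/
theorem completedLContinuation_eq_completedLFunction_of_exists_isNewformOf_of_atkinLehnerMainLemma0
    (hmod : Literature.NumberTheory.EllipticCurves.ModularForms.exists_isNewformOf)
    (hML : ∀ (N : ℕ) [NeZero N], Literature.NumberTheory.EllipticCurves.ModularForms.atkinLehnerMainLemma0 N 2) :
    completedLContinuation_eq_completedLFunction W :=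
  completedLContinuation_eq_completedLFunction_of_completedLFunction_functional_equation
    (completedLFunction_functional_equation_of_modularity W hmod fun N _ ↦
      (Literature.NumberTheory.EllipticCurves.ModularForms.IsNewform0.frickeFacts_of_mainLemma N 2
        (fun h hh ↦ (hML N).mem_oldSubspace0 N 2 h hh)
        (Literature.NumberTheory.EllipticCurves.ModularForms.disjoint_oldSubspace0_newSubspace0_holds N 2)).2.2.2)

/-! ### Second instalment: the strip fact per curve, from modularity alone, from BCDT's inputs

The Atkin–Lehner Main Lemma being a theorem of the tree (`atkinLehnerMainLemma0_holds`, file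
`NewformsMainLemmaTraceProofs`), Hecke's functional equation with sign for weight-`2` newforms
holds at every level (derived from it inline exactly as in the first group; the sibling
`CuspFormLFunctionNewformFrickeProofs` proves it independently, in every weight, as
`IsNewform0.exists_functional_equation_holds`), and the only input left is modularity — per
curve (`IsNewformOf W f`, BCDT §1, condition (2)) or for all curves (`exists_isNewformOf`, BCDT
Thm. A). -/

open scoped MatrixGroups ModularForm in
open CongruenceSubgroup in
/-- **A newform attached to `E` gives a functional equation with some sign `±1`** (per-curve form
of `WeierstrassCurve.exists_hasFunctionalEquationSign_of_modularity` of `BSDRootNumberProofs`,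
same proof). If `f ∈ S₂(Γ₀(N_E))` is a newform with `aₙ(f) = aₙ(E)` for all `n`
(`IsNewformOf W f` — BCDT 2001, §1, condition (2) for `E`, the level being `N(E)`), then Hecke's
entire continuation `Λ` of `Λ_{N_E}(f, s)` with `Λ(s) = i² ε_f Λ(2 − s)` (Hecke 1936;
Diamond–Shurman Thm. 5.10.2; obtained here from the discharged Main Lemma
`atkinLehnerMainLemma0_holds 2 N_E` through `IsNewform0.frickeFacts_of_mainLemma`, as in the
first group) is an entire continuation of `Λ(E, s)` (`IsNewformOf.completedLFunction_eq_holds`),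
and its sign `i² ε_f` equals `(−1)^{r_an} = ±1`
(`eq_neg_one_pow_analyticRank_of_mem_completedLContinuations`), so
`W.HasFunctionalEquationSign ε` for an integer `ε = ±1`. No named fact is used.
[cite: BCDTJAMS2001, §1 (2)] [cite: DiamondShurman2005, Thm. 5.10.2]
[cite: AtkinLehner1970, Thm. 1] -/
theorem exists_hasFunctionalEquationSign_of_isNewformOf [W.IsElliptic]
    [NeZero (W.conductorNorm ℤ)] {f : CuspForm (Gamma0 (W.conductorNorm ℤ)) 2}
    (hf : Literature.NumberTheory.EllipticCurves.ModularForms.IsNewformOf W f) : ∃ ε : ℤ, W.HasFunctionalEquationSign ε := by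
  -- Hecke's functional equation with sign at level `N_E`, weight `2`, from the Main Lemma
  have hfe : Literature.NumberTheory.EllipticCurves.ModularForms.IsNewform0.exists_functional_equation
      (N := W.conductorNorm ℤ) (k := 2) :=
    (Literature.NumberTheory.EllipticCurves.ModularForms.IsNewform0.frickeFacts_of_mainLemma (W.conductorNorm ℤ) 2
      (fun h hh ↦
        (Literature.NumberTheory.EllipticCurves.ModularForms.atkinLehnerMainLemma0_holds 2 (W.conductorNorm ℤ)).mem_oldSubspace0
          (W.conductorNorm ℤ) 2 h hh)
      (Literature.NumberTheory.EllipticCurves.ModularForms.disjoint_oldSubspace0_newSubspace0_holds (W.conductorNorm ℤ) 2)).2.2.2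
  obtain ⟨Λ, hΛ, hΛfe⟩ := hfe hf.1
  have hmem : Λ ∈ W.completedLContinuations (W.conductorNorm ℤ) := by
    refine ⟨hΛ.1, fun s hs ↦ ?_⟩
    refine Literature.NumberTheory.EllipticCurves.ModularForms.IsNewformOf.completedLFunction_eq_holds hf hΛ fun n hn ↦ ?_
    rw [hn] at hs
    simp only [Complex.neg_re, Complex.natCast_re] at hs
    linarith [n.cast_nonneg (α := ℝ)]
  have hfe' : ∀ s : ℂ, Λ (2 - s) =
      (Complex.I ^ (2 : ℤ) * Literature.NumberTheory.EllipticCurves.ModularForms.frickeEigenvalue f) * Λ s := fun s ↦ by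
    have h := hΛfe (2 - s)
    rwa [show (((2 : ℤ) : ℂ) - (2 - s)) = s by push_cast; ring] at h
  have hη := WeierstrassCurve.eq_neg_one_pow_analyticRank_of_mem_completedLContinuations hmem hfe'
  rcases neg_one_pow_eq_or ℂ W.analyticRank with h2 | h2
  · refine ⟨1, Λ, hmem, fun s ↦ ?_⟩
    rw [hfe', hη, h2]
    push_cast
    ring
  · refine ⟨-1, Λ, hmem, fun s ↦ ?_⟩
    rw [hfe', hη, h2]
    push_cast
    ring

open scoped MatrixGroups ModularForm in
open CongruenceSubgroup in
/-- **bsd.S08 on the strip, per curve: "`E` modular ⇒ `Λ_raw(2 − s) = w(E) Λ_raw(s)` on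
`0 < re s < 2`."** If `E` (given by `W`, conductor `N_E = W.conductorNorm ℤ`) has a newform
`f ∈ S₂(Γ₀(N_E))` with `aₙ(f) = aₙ(E)` (`IsNewformOf W f`: BCDT 2001, §1, condition (2), "the
`L`-function `L(E, s)` of `E` equals the `L`-function `L(f, s)` for some eigenform `f` of weight
`2` and level `N(E)`"), then the fact `completedLFunction_functional_equation_strip W` holds: the
functional equation with sign `w(E)` (`exists_hasFunctionalEquationSign_of_isNewformOf`,
`WeierstrassCurve.hasFunctionalEquationSign_rootNumber_of_exists`) transported to the raw product
on the strip by `WeierstrassCurve.completedLFunction_two_sub_holds`. No named fact is used.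
[cite: BCDTJAMS2001, §1 (2)] [cite: DiamondShurman2005, Thm. 5.10.2] -/
theorem completedLFunction_functional_equation_strip_of_isNewformOf [NeZero (W.conductorNorm ℤ)]
    {f : CuspForm (Gamma0 (W.conductorNorm ℤ)) 2} (hf : Literature.NumberTheory.EllipticCurves.ModularForms.IsNewformOf W f) :
    completedLFunction_functional_equation_strip W := by
  intro _ s hs hs'
  exact W.completedLFunction_two_sub_holds
    (W.hasFunctionalEquationSign_rootNumber_of_exists
      (exists_hasFunctionalEquationSign_of_isNewformOf W hf)) hs hs'

/-- **bsd.S08 on the strip, per curve, from "`E` is modular"** in the sense of BCDT's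
Introduction as rendered in `BCDTModularity` (`Literature.BCDT.IsModular W`: there is a newform
`f ∈ S₂(Γ₀(N_E))` attached to `W`). [cite: BCDTJAMS2001, §1 (2)] -/
theorem completedLFunction_functional_equation_strip_of_isModular [NeZero (W.conductorNorm ℤ)]
    (hW : Literature.NumberTheory.Automorphic.BCDT.IsModular W) : completedLFunction_functional_equation_strip W := by
  obtain ⟨f, hf⟩ := hW
  exact completedLFunction_functional_equation_strip_of_isNewformOf W hf

/-- **bsd.S08, raw-product functional equation on the strip, from the Modularity Theorem
alone.** `completedLFunction_functional_equation_strip W` for every `W` from the single named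
fact `Literature.NumberTheory.EllipticCurves.ModularForms.exists_isNewformOf` (Breuil–Conrad–Diamond–Taylor 2001, Thm. A: "If `E/ℚ`
is an elliptic curve, then `E` is modular", in the form (2) of their §1; Diamond–Shurman
Thm. 8.8.3), applied to the given curve
(`completedLFunction_functional_equation_strip_of_isNewformOf`; `N_E ≥ 1` by
`WeierstrassCurve.conductorNorm_pos_holds`). Once the Modularity Theorem is a theorem
`exists_isNewformOf_holds` of the tree, `completedLFunction_functional_equation_strip_holds W` is
`completedLFunction_functional_equation_strip_of_exists_isNewformOf W exists_isNewformOf_holds`.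
[cite: BCDTJAMS2001, Thm. A and §1 (2)] [cite: DiamondShurman2005, Thm. 8.8.3] -/
theorem completedLFunction_functional_equation_strip_of_exists_isNewformOf
    (hmod : Literature.NumberTheory.EllipticCurves.ModularForms.exists_isNewformOf) :
    completedLFunction_functional_equation_strip W := by
  intro _ s hs hs'
  haveI : NeZero (W.conductorNorm ℤ) := ⟨(W.conductorNorm_pos_holds).ne'⟩
  obtain ⟨f, hf⟩ := hmod W
  exact completedLFunction_functional_equation_strip_of_isNewformOf W hf hs hs'

/-- Variant through the first group: `completedLFunction_functional_equation_strip W` from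
modularity by feeding the end-of-chain theorem
`completedLFunction_functional_equation_strip_of_exists_isNewformOf_of_atkinLehnerMainLemma0`
with the *discharged* Atkin–Lehner Main Lemma `Literature.NumberTheory.EllipticCurves.ModularForms.atkinLehnerMainLemma0_holds`
(Atkin–Lehner 1970, Thm. 1; proved in `NewformsMainLemmaTraceProofs`).
[cite: BCDTJAMS2001, Thm. A] [cite: AtkinLehner1970, Thm. 1] -/
theorem completedLFunction_functional_equation_strip_of_exists_isNewformOf'
    (hmod : Literature.NumberTheory.EllipticCurves.ModularForms.exists_isNewformOf) :
    completedLFunction_functional_equation_strip W :=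
  completedLFunction_functional_equation_strip_of_exists_isNewformOf_of_atkinLehnerMainLemma0 W
    hmod fun N _ ↦ Literature.NumberTheory.EllipticCurves.ModularForms.atkinLehnerMainLemma0_holds 2 N

/-- **bsd.S08 on the strip from the inputs of BCDT's proof of Theorem A.**
`completedLFunction_functional_equation_strip W` from Breuil–Conrad–Diamond–Taylor's Theorem B
(= Thm. 2.2.1: every continuous absolutely irreducible `ρ̄ : G_ℚ → GL₂(𝔽₅)` with cyclotomic
determinant is modular; `Literature.NumberTheory.Automorphic.BCDT.theoremB`) and Conrad–Diamond–Taylor 1999, Thm. 7.2.4 (if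
`ρ̄_{E,5}` is modular or `ρ̄_{E,5}|_{ℚ(√5)}` is absolutely reducible then `E` is modular;
`Literature.NumberTheory.Automorphic.BCDT.CDT_theorem_7_2_4`) — the two results from which BCDT §2.2 obtain Thm. 2.2.2 = Thm. A
("Combining this theorem with Theorem 7.2.4 of [CDT] we immediately obtain … Every elliptic
curve defined over the rational numbers is modular"), assembled in the tree as
`Literature.NumberTheory.Automorphic.BCDT.exists_isNewformOf_of_theoremB_of_CDT`. The trust base of the strip fact is thereby
{`theoremB`, `CDT_theorem_7_2_4`}. [cite: BCDTJAMS2001, Thm. 2.2.1 and Thm. 2.2.2 (§2.2)]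
[cite: ConradDiamondTaylor1999, Thm. 7.2.4] -/
theorem completedLFunction_functional_equation_strip_of_theoremB_of_CDT
    (hB : Literature.NumberTheory.Automorphic.BCDT.theoremB) (hCDT : Literature.NumberTheory.Automorphic.BCDT.CDT_theorem_7_2_4) :
    completedLFunction_functional_equation_strip W :=
  completedLFunction_functional_equation_strip_of_exists_isNewformOf W
    (Literature.NumberTheory.Automorphic.BCDT.exists_isNewformOf_of_theoremB_of_CDT hB hCDT)

end Literature.NumberTheory.EllipticCurves

end
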